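import Mathlib
import Summits.Schanuel.Schanuel.Theorems.RigidCoreMinimalCounterexampleInAclLogSector
import Summits.Schanuel.Schanuel.Theorems.MinimalCounterexampleInAcl.Negative.IsolationFree
import Summits.Schanuel.Schanuel.Theorems.AclSubsetLogFreeCore.Negative.ExpAclDefinability

/-!
# The selection core of second-level selection — crux stmt-Schanuel-0969, stub `stub_selectionCore`

Route `RigidCore`, crux (S*) `MinimalCounterexampleInAcl` (item stmt-Schanuel-0969), line
`kernel-arithmetic-selection` (lead prover-line-stmt-Schanuel-0969-c6-0, skeleton gen 19), landed
`--supports stmt-Schanuel-0969`.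

**Stub C — THE SELECTION CORE (definability + growth contradiction), PROVED.**  Let `x` be a rank-2 first
failure and `Φ` a `∅`-definable function on `ℂ²` decaying super-polynomially along the mates of `x`
(`‖Φ y‖ (1+‖y₀‖)^M ≤ 1` beyond `R_M`, every `M`); assume two-sided polynomial size of the values `F(y, e^y)`,
`F ∈ ℚ[w, z]`, along the locus (lower bound when `F(x, eˣ) ≠ 0`) and finiteness of the sets of mates bounded
in `y₀`.  Then a relation `Σ_j c_j(x, eˣ) Φ(x)^j = 0` with `c₀(x, eˣ) ≠ 0` puts both coordinates of `x` in
`acl^{ℂ_exp}(∅)`: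

* `definable_selectionSet` — the selection set `S = {y mate of x | Σ_j c_j(y, e^y) Φ(y)^j = 0}` is ONE
  `∅`-formula (mates are `∅`-definable: `locusMates_definable`; exponential polynomials, products, powers and
  finite sums of `∅`-definable functions are `∅`-definable);
* `selectionSet_bounded` — `S` is bounded in `y₀`: at a point of `S` with `‖y₀‖ = r` large,
  `C₀⁻¹(1+r)^{-D₀} ≤ ‖c₀(y, e^y)‖ = ‖Σ_{j≥1} c_j(y, e^y) Φ(y)^j‖ ≤ (Σ_j C_j)(1+r)^{Σ_j D_j} ‖Φ y‖`, and with
  the decay at `M = D₀ + Σ_j D_j + 1` this forces `1 + r ≤ C₀ Σ_j C_j` (`one_add_le_of_sandwich`,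
  `norm_head_le_of_sum_eq_zero`);
* `stub_selectionCore` — hence `S` is finite (`hloc`), `∅`-definable, contains `x`, and its coordinate
  projections are finite `∅`-definable subsets of `ℂ` (`coord_mem_expAcl`).

## References

* [KirbyMacintyreOnshuus2012] J. Kirby, A. Macintyre, A. Onshuus, *The algebraic numbers definable in
  various exponential fields*, J. Inst. Math. Jussieu 11 (2012), arXiv:1101.4224, §2 (parameter-free
  definability in `ℂ_exp`).
* D. Marker, *Model Theory: An Introduction*, GTM 217, §1.3 (definable sets, `acl`).
-/

noncomputable section

set_option linter.dupNamespace false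

open Complex Set FirstOrder

namespace Summit.Schanuel.Schanuel.Cruxes.MinimalCounterexampleInAcl.KernelArithmeticSelection

open Literature.ModelTheory.ExponentialFields
open Summit.Schanuel.Schanuel.Theorems.AclSubsetLogFreeCore.Negative
open Summit.Schanuel.Schanuel.Theorems.MinimalCounterexampleInAcl.Negative

/-! ## Definability of the selection set -/

/-- Powers of a `∅`-definable function are `∅`-definable. [folklore] -/
theorem definableFun_pow' {α : Type*} {g : (α → ℂ) → ℂ}
    (hg : (∅ : Set ℂ).DefinableFun Language.expRing g) (k : ℕ) :
    (∅ : Set ℂ).DefinableFun Language.expRing (fun v => g v ^ k) := by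
  induction k with
  | zero => simpa using (definableFun_one' (A := (∅ : Set ℂ)) (α := α))
  | succ k ih => simpa [pow_succ] using definableFun_mul' ih hg

/-- The second-level relation `y ↦ Σ_j c_j(y, e^y) Φ(y)^j` is a `∅`-definable function for `∅`-definable
`Φ`. [folklore] -/
theorem definableFun_relation {n d : ℕ} {Φ : (Fin n → ℂ) → ℂ}
    (hΦ : (∅ : Set ℂ).DefinableFun Language.expRing Φ) (c : Fin (d + 1) → MvPolynomial (Fin n ⊕ Fin n) ℚ) :
    (∅ : Set ℂ).DefinableFun Language.expRing (fun y : Fin n → ℂ =>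
      ∑ j : Fin (d + 1), MvPolynomial.aeval (Sum.elim y (cexp ∘ y)) (c j) * Φ y ^ (j : ℕ)) :=
  definableFun_finset_sum Finset.univ
    (f := fun (j : Fin (d + 1)) (y : Fin n → ℂ) =>
      MvPolynomial.aeval (Sum.elim y (cexp ∘ y)) (c j) * Φ y ^ (j : ℕ))
    fun j _ => definableFun_mul' (definableFun_expPoly (c j)) (definableFun_pow' hΦ j)

/-- **The selection set is ONE `∅`-formula**: the mates `y` of `x` with `Σ_j c_j(y, e^y) Φ(y)^j = 0` form a
`∅`-definable subset of `ℂⁿ`. [folklore] -/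
theorem definable_selectionSet {n d : ℕ} (x : Fin n → ℂ) {Φ : (Fin n → ℂ) → ℂ}
    (hΦ : (∅ : Set ℂ).DefinableFun Language.expRing Φ) (c : Fin (d + 1) → MvPolynomial (Fin n ⊕ Fin n) ℚ) :
    (∅ : Set ℂ).Definable Language.expRing {y : Fin n → ℂ | y ∈ locusMates x ∧
      ∑ j : Fin (d + 1), MvPolynomial.aeval (Sum.elim y (cexp ∘ y)) (c j) * Φ y ^ (j : ℕ) = 0} :=
  (locusMates_definable x).inter
    (definable_setOf_eq_params (definableFun_relation hΦ c) definableFun_zero')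

/-! ## The growth contradiction (real bookkeeping) -/

/-- Sandwich bookkeeping: `C₀⁻¹ (1+r)^{-D₀} ≤ a ≤ C_s (1+r)^{D_s} φ` together with the decay
`φ (1+r)^{D₀+D_s+1} ≤ 1` forces `1 + r ≤ C₀ C_s`. -/
theorem one_add_le_of_sandwich {C₀ Cs r φ a : ℝ} {D₀ Ds : ℕ} (hC₀ : 0 < C₀) (hCs : 0 ≤ Cs) (hr : 0 ≤ r)
    (hlow : C₀⁻¹ * ((1 + r) ^ D₀)⁻¹ ≤ a) (hup : a ≤ Cs * (1 + r) ^ Ds * φ)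
    (hdec : φ * (1 + r) ^ (D₀ + Ds + 1) ≤ 1) : 1 + r ≤ C₀ * Cs := by
  have ht : 0 < 1 + r := by linarith
  have h1 : 1 ≤ C₀ * Cs * (φ * ((1 + r) ^ D₀ * (1 + r) ^ Ds)) := by
    have h := hlow.trans hup
    rw [← mul_inv, inv_le_iff_one_le_mul₀ (by positivity)] at h
    calc (1 : ℝ) ≤ Cs * (1 + r) ^ Ds * φ * (C₀ * (1 + r) ^ D₀) := h
      _ = C₀ * Cs * (φ * ((1 + r) ^ D₀ * (1 + r) ^ Ds)) := by ring
  calc 1 + r = (1 + r) * 1 := (mul_one _).symm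
    _ ≤ (1 + r) * (C₀ * Cs * (φ * ((1 + r) ^ D₀ * (1 + r) ^ Ds))) := mul_le_mul_of_nonneg_left h1 ht.le
    _ = C₀ * Cs * (φ * (1 + r) ^ (D₀ + Ds + 1)) := by ring
    _ ≤ C₀ * Cs * 1 := mul_le_mul_of_nonneg_left hdec (mul_nonneg hC₀.le hCs)
    _ = C₀ * Cs := mul_one _

/-- Head-coefficient bound: if `Σ_{j ≤ d} a_j φ^j = 0`, `‖a_j‖ ≤ C_j (1+r)^{D_j}` with `C_j > 0`, and `‖φ‖ ≤ 1`,
then `‖a₀‖ ≤ (Σ_j C_j) (1+r)^{Σ_j D_j} ‖φ‖`. -/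
theorem norm_head_le_of_sum_eq_zero {d : ℕ} (a : Fin (d + 1) → ℂ) (φ : ℂ) (C : Fin (d + 1) → ℝ)
    (D : Fin (d + 1) → ℕ) {r : ℝ} (hr : 0 ≤ r) (hsum : ∑ j, a j * φ ^ (j : ℕ) = 0) (hC : ∀ j, 0 < C j)
    (ha : ∀ j, ‖a j‖ ≤ C j * (1 + r) ^ D j) (hφ : ‖φ‖ ≤ 1) :
    ‖a 0‖ ≤ (∑ j, C j) * (1 + r) ^ (∑ j, D j) * ‖φ‖ := by
  have ht : 1 ≤ 1 + r := by linarith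
  have ht0 : 0 ≤ 1 + r := by linarith
  have h0 : a 0 = -∑ j : Fin d, a j.succ * φ ^ ((j : ℕ) + 1) := by
    rw [Fin.sum_univ_succ] at hsum
    simp only [Fin.val_zero, pow_zero, mul_one, Fin.val_succ] at hsum
    exact eq_neg_of_add_eq_zero_left hsum
  have hDle : ∀ j, D j ≤ ∑ i, D i := fun j =>
    Finset.single_le_sum (f := D) (fun i _ => Nat.zero_le _) (Finset.mem_univ j)
  have hterm : ∀ j : Fin d,
      ‖a j.succ * φ ^ ((j : ℕ) + 1)‖ ≤ C j.succ * ((1 + r) ^ (∑ i, D i) * ‖φ‖) := by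
    intro j
    rw [norm_mul, norm_pow]
    calc ‖a j.succ‖ * ‖φ‖ ^ ((j : ℕ) + 1) ≤ C j.succ * (1 + r) ^ D j.succ * ‖φ‖ :=
          mul_le_mul (ha j.succ) (pow_le_of_le_one (norm_nonneg _) hφ (Nat.succ_ne_zero _))
            (pow_nonneg (norm_nonneg _) _) (mul_nonneg (hC j.succ).le (pow_nonneg ht0 _))
      _ ≤ C j.succ * (1 + r) ^ (∑ i, D i) * ‖φ‖ :=
          mul_le_mul_of_nonneg_right
            (mul_le_mul_of_nonneg_left (pow_le_pow_right₀ ht (hDle j.succ)) (hC j.succ).le) (norm_nonneg _)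
      _ = C j.succ * ((1 + r) ^ (∑ i, D i) * ‖φ‖) := mul_assoc _ _ _
  have hCle : ∑ j : Fin d, C j.succ ≤ ∑ j, C j := by
    rw [Fin.sum_univ_succ]
    linarith [hC 0]
  calc ‖a 0‖ = ‖∑ j : Fin d, a j.succ * φ ^ ((j : ℕ) + 1)‖ := by rw [h0, norm_neg]
    _ ≤ ∑ j : Fin d, ‖a j.succ * φ ^ ((j : ℕ) + 1)‖ := norm_sum_le _ _
    _ ≤ ∑ j : Fin d, C j.succ * ((1 + r) ^ (∑ i, D i) * ‖φ‖) := Finset.sum_le_sum fun j _ => hterm j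
    _ = (∑ j : Fin d, C j.succ) * ((1 + r) ^ (∑ i, D i) * ‖φ‖) := by rw [Finset.sum_mul]
    _ ≤ (∑ j, C j) * ((1 + r) ^ (∑ i, D i) * ‖φ‖) :=
        mul_le_mul_of_nonneg_right hCle (mul_nonneg (pow_nonneg ht0 _) (norm_nonneg _))
    _ = (∑ j, C j) * (1 + r) ^ (∑ j, D j) * ‖φ‖ := (mul_assoc _ _ _).symm

/-! ## The selection set is bounded, hence finite; conclusion -/

/-- **The selection set is bounded in `y₀`.**  Under super-polynomial decay of `Φ` along the mates and two-sided
polynomial size of the coefficients `c_j(y, e^y)` along the locus (lower bound for `c₀`, `c₀(x, eˣ) ≠ 0`), every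
mate `y` of `x` with `Σ_j c_j(y, e^y) Φ(y)^j = 0` has `‖y₀‖ ≤ R*`, where `R*` dominates the thresholds and
`C₀ Σ_j C_j`. -/
theorem selectionSet_bounded {x : Fin 2 → ℂ} {Φ : (Fin 2 → ℂ) → ℂ}
    (hdecay : ∀ M : ℕ, ∃ R : ℝ, ∀ y : Fin 2 → ℂ, y ∈ locusMates x → R ≤ ‖y 0‖ →
      ‖Φ y‖ * (1 + ‖y 0‖) ^ M ≤ 1)
    (hgrowth : ∀ F : MvPolynomial (Fin 2 ⊕ Fin 2) ℚ, ∃ R C : ℝ, ∃ D : ℕ, 0 < C ∧ ∀ y : Fin 2 → ℂ,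
      y ∈ locusPts x → R ≤ ‖y 0‖ →
        ‖MvPolynomial.aeval (Sum.elim y (cexp ∘ y)) F‖ ≤ C * (1 + ‖y 0‖) ^ D ∧
        (MvPolynomial.aeval (Sum.elim x (cexp ∘ x)) F ≠ 0 →
          C⁻¹ * ((1 + ‖y 0‖) ^ D)⁻¹ ≤ ‖MvPolynomial.aeval (Sum.elim y (cexp ∘ y)) F‖))
    {d : ℕ} (c : Fin (d + 1) → MvPolynomial (Fin 2 ⊕ Fin 2) ℚ)
    (hc0 : MvPolynomial.aeval (Sum.elim x (cexp ∘ x)) (c 0) ≠ 0) :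
    ∃ R : ℝ, ∀ y : Fin 2 → ℂ, y ∈ locusMates x →
      ∑ j : Fin (d + 1), MvPolynomial.aeval (Sum.elim y (cexp ∘ y)) (c j) * Φ y ^ (j : ℕ) = 0 →
        ‖y 0‖ ≤ R := by
  choose Rj Cj Dj hCj hj using fun j => hgrowth (c j)
  obtain ⟨RM, hM⟩ := hdecay (Dj 0 + ∑ j, Dj j + 1)
  obtain ⟨Rmax, hRmax⟩ := Finite.exists_le Rj
  refine ⟨max (max RM Rmax) (Cj 0 * ∑ j, Cj j), fun y hy hsum => not_lt.1 fun hlt => ?_⟩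
  simp only [max_lt_iff] at hlt
  obtain ⟨⟨hRM, hRmax'⟩, hCC⟩ := hlt
  have hyP : y ∈ locusPts x := hy.2
  have hdec := hM y hy hRM.le
  have hone : (1 : ℝ) ≤ (1 + ‖y 0‖) ^ (Dj 0 + ∑ j, Dj j + 1) :=
    one_le_pow₀ (by linarith [norm_nonneg (y 0)])
  have hφ1 : ‖Φ y‖ ≤ 1 :=
    calc ‖Φ y‖ = ‖Φ y‖ * 1 := (mul_one _).symm
      _ ≤ ‖Φ y‖ * (1 + ‖y 0‖) ^ (Dj 0 + ∑ j, Dj j + 1) := mul_le_mul_of_nonneg_left hone (norm_nonneg _)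
      _ ≤ 1 := hdec
  have hup : ∀ j, ‖MvPolynomial.aeval (Sum.elim y (cexp ∘ y)) (c j)‖ ≤ Cj j * (1 + ‖y 0‖) ^ Dj j :=
    fun j => (hj j y hyP ((hRmax j).trans hRmax'.le)).1
  have hlow := (hj 0 y hyP ((hRmax 0).trans hRmax'.le)).2 hc0
  have hhead := norm_head_le_of_sum_eq_zero (fun j => MvPolynomial.aeval (Sum.elim y (cexp ∘ y)) (c j))
    (Φ y) Cj Dj (norm_nonneg (y 0)) hsum hCj hup hφ1
  have key := one_add_le_of_sandwich (hCj 0) (Finset.sum_nonneg fun j _ => (hCj j).le)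
    (norm_nonneg (y 0)) hlow hhead hdec
  linarith

/-- **Stub C — THE SELECTION CORE (registered stub `stub_selectionCore`, PROVED).**  Let `x` be a rank-2 first
failure and `Φ` a `∅`-definable function decaying super-polynomially along the mates (`‖Φ y‖ (1+‖y₀‖)^M ≤ 1`
beyond `R_M`, every `M`); assume two-sided polynomial size of `K`-elements along the locus (Stub G) and
finiteness of bounded sets of mates (Stub L).  Then a relation `Σ_j c_j(x, eˣ) Φ(x)^j = 0` with
`c₀(x, eˣ) ≠ 0` puts both coordinates of `x` in `acl(∅)`: the set `S = {y mate | Σ_j c_j(y, e^y) Φ(y)^j = 0}`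
is ONE `∅`-formula, contains `x`, and a point of `S` with `‖y₀‖` large would give
`C₀⁻¹(1+‖y₀‖)^{−D₀} ≤ ‖c₀(y, e^y)‖ = ‖Σ_{j≥1} c_j(y, e^y) Φ(y)^j‖ ≤ (Σ C_j)(1+‖y₀‖)^{Σ D_j} ‖Φ y‖`,
contradicting the decay; so `S` is bounded in `y₀`, hence finite, and its coordinate projections are finite
`∅`-definable sets. -/
theorem stub_selectionCore : ∀ (x : Fin 2 → ℂ), x ∈ Summit.Schanuel.Schanuel.Cruxes.MinimalCounterexampleInAcl.KernelArithmeticSelection.firstFailures 2 → ∀ (Φ : (Fin 2 → ℂ) → ℂ), (∅ : Set ℂ).DefinableFun Literature.ModelTheory.ExponentialFields.Language.expRing Φ → (∀ M : ℕ, ∃ R : ℝ, ∀ y : Fin 2 → ℂ, y ∈ Summit.Schanuel.Schanuel.Cruxes.MinimalCounterexampleInAcl.KernelArithmeticSelection.locusMates x → R ≤ ‖y 0‖ → ‖Φ y‖ * (1 + ‖y 0‖) ^ M ≤ 1) → (∀ F : MvPolynomial (Fin 2 ⊕ Fin 2) ℚ, ∃ R C : ℝ, ∃ D : ℕ, 0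 < C ∧ ∀ y : Fin 2 → ℂ, y ∈ Summit.Schanuel.Schanuel.Cruxes.MinimalCounterexampleInAcl.KernelArithmeticSelection.locusPts x → R ≤ ‖y 0‖ → ‖MvPolynomial.aeval (Sum.elim y (Complex.exp ∘ y)) F‖ ≤ C * (1 + ‖y 0‖) ^ D ∧ (MvPolynomial.aeval (Sum.elim x (Complex.exp ∘ x)) F ≠ 0 → C⁻¹ * ((1 + ‖y 0‖) ^ D)⁻¹ ≤ ‖MvPolynomial.aeval (Sum.elim y (Complex.exp ∘ y)) F‖)) → (∀ R : ℝ, Set.Finite {y : Fin 2 → ℂ | y ∈ Summit.Schanuel.Schanuel.Cruxes.MinimalCounterexampleInAcl.KernelArithmeticSelection.locusMates x ∧ ‖y 0‖ ≤ R}) → ∀ (d : ℕ) (c : Fin (d + 1) → MvPolynomial (Fin 2 ⊕ Fin 2) ℚ), MvPolynomial.aeval (Sum.elim x (Complex.exp ∘ x)) (c 0) ≠ 0 → ∑ j : Fin (d + 1), MvPolynomial.aeval (Sum.elim x (Complex.exp ∘ x)) (c j) * Φ x ^ (j : ℕ) = 0 → ∀ i, x i ∈ Summit.Schanuel.Schanuel.Theorems.AclSubsetLogFreeCore.Negative.expAcl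 := by
  intro x hx Φ hΦ hdecay hgrowth hloc d c hc0 hrel i
  obtain ⟨R, hR⟩ := selectionSet_bounded hdecay hgrowth c hc0
  have hfin : Set.Finite {y : Fin 2 → ℂ | y ∈ locusMates x ∧
      ∑ j : Fin (d + 1), MvPolynomial.aeval (Sum.elim y (cexp ∘ y)) (c j) * Φ y ^ (j : ℕ) = 0} :=
    (hloc R).subset fun y hy => ⟨hy.1, hR y hy.1 hy.2⟩
  exact coord_mem_expAcl hfin (definable_selectionSet x hΦ c) ⟨self_mem_locusMates x hx.1, hrel⟩ i

end Summit.Schanuel.Schanuel.Cruxes.MinimalCounterexampleInAcl.KernelArithmeticSelection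

end
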